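import Summits.HodgeConjecture.HodgeConjecture.Theses.NoetherLefschetzOneUp
import Literature.AlgebraicGeometry.HodgeTheory.GysinFormalism
import Literature.AlgebraicGeometry.Motives.FamiliesVHS

/-!
# Birth skeleton (BC3) of the piece `HigherNetClasses` — net classes modulo vertical at every level `m ≥ 4`, granted all lower levels
# (crux piece of the decomposition of `SummitGrantedFourfolds`, stmt-HodgeConjecture-14600)

Piece of the crux-strategist decomposition of `SummitGrantedFourfolds` (route `NoetherLefschetzOneUp`;
line `Cruxes/SummitGrantedFourfolds/Lines/netRegimeSplit.lean`). On a smooth projective `2m`-fold `X`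
with a surjective `f : X ⟶ ℙ²` write `V` for the span of the rational `(m,m)`-classes, `A` for
`algebraicClasses X m` and `V_f` for the span of the rational `(m,m)`-classes vanishing off `f⁻¹(T)`
for some proper closed `T ⊊ ℙ²` (vertical classes). The piece is `V ≤ A ⊔ V_f`. Along the net it
splits by FIBRE RESTRICTION (Leray: `L⁰/L¹` against `L¹`):

* `stub_fibreRestriction` — THE FIBREWISE PART IS ALGEBRAIC (provable in print; where the granted
  lower levels are used): for a rational `(m,m)`-class `c` there are an algebraic class `a` and a proper
  closed `T` with `(c - a)|_(X_s) = 0` for every rational point `s ∉ T`. Indeed `c|_(X_s)` lies in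
  `H^(2m)` of the `(2m-2)`-fold fibre `X_s`, which is `L² · H^(2m-4)(X_s)` by hard Lefschetz on the
  fibre, so it is `L²c₀` with `c₀` a rational `(m-2,m-2)`-class — algebraic on the fibre (level `3`:
  Lefschetz `(1,1)`; level `m ≥ 4`: the Hodge conjecture in codimension `m-2` on `(2m-2)`-folds, which
  the granted levels give by de Cataldo–Migliorini below the middle and hard Lefschetz) —; the
  fibrewise cycles over a Zariski-dense set of `s` come from finitely many components of the relative
  Hilbert scheme, one of which dominates `ℙ²`, and the closure of the corresponding family (divided by
  the degree of its multisection base) is a cycle on `X` with the same fibre restrictions off a proper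
  closed `T` (the spreading argument of de Cataldo–Migliorini §4 / Voisin II §10.2.1, over a
  two-dimensional base).
* `stub_fibreTrivial` — FIBRE-TRIVIAL CLASSES ARE ALGEBRAIC MODULO VERTICAL (the OPEN core): a class
  of `V ⊔ A` restricting to zero on the fibres off a proper closed `T` lies in `A ⊔ V_f`. In Leray
  terms over `U = ℙ² ∖ (T ∪ Δ)` these are the classes in `L¹`: the normal-function piece
  `H¹(U, j_*R^(2m-1)f_*)` (intermediate Jacobians of the fibres — the barrier `NormalFunctions` when
  the fibres have `h^(2m-3,0)`-type transcendence) and the piece `H²(U, R^(2m-2)f_*)` = flat middle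
  classes of the fibres cup base classes (algebraic on the geometric generic fibre by the granted level
  `m-1`, spread to relative cycles) plus the transcendental middle variation `𝕍` (NL-Gysin classes —
  algebraic on the fibres over the Hodge-locus curves by level `m-1` — and multisections; the theta
  audit when `𝕍` is of K3 type), everything deeper being vertical.
* `HigherNetClasses_of` (no `sorry`): for `c ∈ V` take `a, T` from stub 1; `c - a ∈ V ⊔ A` is fibre-trivial off
  `T`, so lies in `A ⊔ V_f` by stub 2; add `a ∈ A`.

The conclusion is the piece's statement VERBATIM (the piece is not yet a route decl: the route split is
staged, `children.json`; once it lands, replace the conclusion by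
`Summit.HodgeConjecture.HodgeConjecture.Theses.NoetherLefschetzOneUp.HigherNetClasses` — `Iff.rfl`).
`sorry` occurs only inside the two `stub_*` theorems.
-/

set_option linter.dupNamespace false

noncomputable section

namespace Summit.HodgeConjecture.HodgeConjecture.Cruxes.SummitGrantedFourfolds.HigherNetClassesBirth

open CategoryTheory AlgebraicGeometry
open Literature.AlgebraicGeometry Literature.AlgebraicGeometry.Motives
open Literature.AlgebraicGeometry.HodgeTheory

/-- **Stub 1 — fibre restriction: every rational `(m,m)`-class agrees off a proper closed `T` with an
ALGEBRAIC class on the fibres** (provable in print: hard Lefschetz on the fibre + the Hodge conjecture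
in codimension `m-2` on the `(2m-2)`-fold fibres from the granted levels + spreading of fibrewise
cycles through the relative Hilbert scheme over `ℙ²`).
[DecataldoMigliorini2009 §4; VoisinHodgeII2003 §10.2.1; Arapura2022 §1] -/
theorem stub_fibreRestriction :
    ∀ ⦃m : ℕ⦄, 4 ≤ m → (∀ m' : ℕ, m' < m → ∀ ⦃X : Literature.AlgebraicGeometry.Motives.SchemeOver ℂ⦄, Literature.AlgebraicGeometry.Motives.IsSmoothProjective (2 * m') X → ∀ c : Literature.AlgebraicGeometry.HodgeTheory.complexBetti X (2 * m'), Literature.AlgebraicGeometry.HodgeTheory.IsRationalClass c → Literature.AlgebraicGeometry.HodgeTheory.IsOfHodgeType (2 * m') X (2 * m') m' m' c → c ∈ Literature.AlgebraicGeometry.HodgeTheory.algebraicClasses X m') → ∀ ⦃X : Literature.AlgebraicGeometry.Motives.SchemeOver ℂ⦄ (f : X ⟶ Literature.AlgebraicGeometry.Motives.projectiveSpace 2 ℂ), Literature.AlgebraicGeometry.Motives.IsSmoothProjective (2 * m) X → Function.Surjective f.left.base → ∀ c : Literature.AlgebraicGeometry.HodgeTheory.complexBetti X (2 * m), Literature.AlgebraicGeometry.HodgeTheory.IsRationalClass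 c → Literature.AlgebraicGeometry.HodgeTheory.IsOfHodgeType (2 * m) X (2 * m) m m c → ∃ a ∈ Literature.AlgebraicGeometry.HodgeTheory.algebraicClasses X m, ∃ T : Set (Literature.AlgebraicGeometry.Motives.projectiveSpace 2 ℂ).left, IsClosed T ∧ T ≠ Set.univ ∧ ∀ s : Literature.AlgebraicGeometry.Motives.AlgPoints (Literature.AlgebraicGeometry.Motives.projectiveSpace 2 ℂ) ℂ, s.pt ∉ T → Literature.AlgebraicGeometry.HodgeTheory.complexBetti.map (Literature.AlgebraicGeometry.Motives.fiberι f s) (2 * m) (c - a) = 0 := by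
  sorry

/-- **Stub 2 — fibre-trivial classes lie in algebraic ⊔ vertical** (OPEN core: Leray `L¹` = normal
functions `H¹(U, j_*R^(2m-1))` + `H²(U, R^(2m-2))` (flat middle classes of the fibres, NL-Gysin classes
and multisections of the transcendental variation), deeper = vertical).
[Arapura2022 Cor. 1.4; Zucker1977; Green1989NLComponents; Garcia2016] -/
theorem stub_fibreTrivial :
    ∀ ⦃m : ℕ⦄, 4 ≤ m → (∀ m' : ℕ, m' < m → ∀ ⦃X : Literature.AlgebraicGeometry.Motives.SchemeOver ℂ⦄, Literature.AlgebraicGeometry.Motives.IsSmoothProjective (2 * m') X → ∀ c : Literature.AlgebraicGeometry.HodgeTheory.complexBetti X (2 * m'), Literature.AlgebraicGeometry.HodgeTheory.IsRationalClass c → Literature.AlgebraicGeometry.HodgeTheory.IsOfHodgeType (2 * m') X (2 * m') m' m' c → c ∈ Literature.AlgebraicGeometry.HodgeTheory.algebraicClasses X m') → ∀ ⦃X : Literature.AlgebraicGeometry.Motives.SchemeOver ℂ⦄ (f : X ⟶ Literature.AlgebraicGeometry.Motives.projectiveSpace 2 ℂ), Literature.AlgebraicGeometry.Motives.IsSmoothProjective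 (2 * m) X → Function.Surjective f.left.base → ∀ c : Literature.AlgebraicGeometry.HodgeTheory.complexBetti X (2 * m), c ∈ Submodule.span ℂ {c : Literature.AlgebraicGeometry.HodgeTheory.complexBetti X (2 * m) | Literature.AlgebraicGeometry.HodgeTheory.IsRationalClass c ∧ Literature.AlgebraicGeometry.HodgeTheory.IsOfHodgeType (2 * m) X (2 * m) m m c} ⊔ Literature.AlgebraicGeometry.HodgeTheory.algebraicClasses X m → (∃ T : Set (Literature.AlgebraicGeometry.Motives.projectiveSpace 2 ℂ).left, IsClosed T ∧ T ≠ Set.univ ∧ ∀ s : Literature.AlgebraicGeometry.Motives.AlgPoints (Literature.AlgebraicGeometry.Motives.projectiveSpace 2 ℂ) ℂ, s.pt ∉ T → Literature.AlgebraicGeometry.HodgeTheory.complexBetti.map (Literature.AlgebraicGeometry.Motives.fiberι f s) (2 * m) c = 0) → c ∈ Literature.AlgebraicGeometry.HodgeTheory.algebraicClasses X m ⊔ Submodule.span ℂ {c : Literature.AlgebraicGeometry.HodgeTheory.complexBetti X (2 * m) | Literature.AlgebraicGeometry.HodgeTheory.IsRationalClass c ∧ Literature.AlgebraicGeometry.HodgeTheory.IsOfHodgeType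 (2 * m) X (2 * m) m m c ∧ ∃ T : Set (Literature.AlgebraicGeometry.Motives.projectiveSpace 2 ℂ).left, IsClosed T ∧ T ≠ Set.univ ∧ Literature.AlgebraicGeometry.HodgeTheory.complexBetti.restrictCompl X (f.left.base ⁻¹' T) (2 * m) c = 0} := by
  sorry

/-- **Assembly, implication form** (kernel-checked, no `sorry`): the two stubs imply the piece
`HigherNetClasses` (statement verbatim): for a rational `(m,m)`-class `c` take the algebraic `a` and the
closed `T` of stub 1; `c - a` is in `V ⊔ A` and fibre-trivial off `T`, hence in `A ⊔ V_f` by stub 2;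
and `c = (c - a) + a`. -/
theorem HigherNetClasses_of :
    (∀ ⦃m : ℕ⦄, 4 ≤ m → (∀ m' : ℕ, m' < m → ∀ ⦃X : Literature.AlgebraicGeometry.Motives.SchemeOver ℂ⦄, Literature.AlgebraicGeometry.Motives.IsSmoothProjective (2 * m') X → ∀ c : Literature.AlgebraicGeometry.HodgeTheory.complexBetti X (2 * m'), Literature.AlgebraicGeometry.HodgeTheory.IsRationalClass c → Literature.AlgebraicGeometry.HodgeTheory.IsOfHodgeType (2 * m') X (2 * m') m' m' c → c ∈ Literature.AlgebraicGeometry.HodgeTheory.algebraicClasses X m') → ∀ ⦃X : Literature.AlgebraicGeometry.Motives.SchemeOver ℂ⦄ (f : X ⟶ Literature.AlgebraicGeometry.Motives.projectiveSpace 2 ℂ), Literature.AlgebraicGeometry.Motives.IsSmoothProjective (2 * m) X → Function.Surjective f.left.base → ∀ c : Literature.AlgebraicGeometry.HodgeTheory.complexBetti X (2 * m), Literature.AlgebraicGeometry.HodgeTheory.IsRationalClass c → Literature.AlgebraicGeometry.HodgeTheory.IsOfHodgeType (2 * m) X (2 * m) m m c → ∃ a ∈ Literature.AlgebraicGeometry.HodgeTheory.algebraicClasses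 X m, ∃ T : Set (Literature.AlgebraicGeometry.Motives.projectiveSpace 2 ℂ).left, IsClosed T ∧ T ≠ Set.univ ∧ ∀ s : Literature.AlgebraicGeometry.Motives.AlgPoints (Literature.AlgebraicGeometry.Motives.projectiveSpace 2 ℂ) ℂ, s.pt ∉ T → Literature.AlgebraicGeometry.HodgeTheory.complexBetti.map (Literature.AlgebraicGeometry.Motives.fiberι f s) (2 * m) (c - a) = 0) →
    (∀ ⦃m : ℕ⦄, 4 ≤ m → (∀ m' : ℕ, m' < m → ∀ ⦃X : Literature.AlgebraicGeometry.Motives.SchemeOver ℂ⦄, Literature.AlgebraicGeometry.Motives.IsSmoothProjective (2 * m') X → ∀ c : Literature.AlgebraicGeometry.HodgeTheory.complexBetti X (2 * m'), Literature.AlgebraicGeometry.HodgeTheory.IsRationalClass c → Literature.AlgebraicGeometry.HodgeTheory.IsOfHodgeType (2 * m') X (2 * m') m' m' c → c ∈ Literature.AlgebraicGeometry.HodgeTheory.algebraicClasses X m') → ∀ ⦃X : Literature.AlgebraicGeometry.Motives.SchemeOver ℂ⦄ (f : X ⟶ Literature.AlgebraicGeometry.Motives.projectiveSpace 2 ℂ),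 Literature.AlgebraicGeometry.Motives.IsSmoothProjective (2 * m) X → Function.Surjective f.left.base → ∀ c : Literature.AlgebraicGeometry.HodgeTheory.complexBetti X (2 * m), c ∈ Submodule.span ℂ {c : Literature.AlgebraicGeometry.HodgeTheory.complexBetti X (2 * m) | Literature.AlgebraicGeometry.HodgeTheory.IsRationalClass c ∧ Literature.AlgebraicGeometry.HodgeTheory.IsOfHodgeType (2 * m) X (2 * m) m m c} ⊔ Literature.AlgebraicGeometry.HodgeTheory.algebraicClasses X m → (∃ T : Set (Literature.AlgebraicGeometry.Motives.projectiveSpace 2 ℂ).left, IsClosed T ∧ T ≠ Set.univ ∧ ∀ s : Literature.AlgebraicGeometry.Motives.AlgPoints (Literature.AlgebraicGeometry.Motives.projectiveSpace 2 ℂ) ℂ, s.pt ∉ T → Literature.AlgebraicGeometry.HodgeTheory.complexBetti.map (Literature.AlgebraicGeometry.Motives.fiberι f s) (2 * m) c = 0) → c ∈ Literature.AlgebraicGeometry.HodgeTheory.algebraicClasses X m ⊔ Submodule.span ℂ {c : Literature.AlgebraicGeometry.HodgeTheory.complexBetti X (2 * m) | Literature.AlgebraicGeometry.HodgeTheory.IsRationalClass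 c ∧ Literature.AlgebraicGeometry.HodgeTheory.IsOfHodgeType (2 * m) X (2 * m) m m c ∧ ∃ T : Set (Literature.AlgebraicGeometry.Motives.projectiveSpace 2 ℂ).left, IsClosed T ∧ T ≠ Set.univ ∧ Literature.AlgebraicGeometry.HodgeTheory.complexBetti.restrictCompl X (f.left.base ⁻¹' T) (2 * m) c = 0}) →
    ∀ ⦃m : ℕ⦄, 4 ≤ m → (∀ m' : ℕ, m' < m → ∀ ⦃X : Literature.AlgebraicGeometry.Motives.SchemeOver ℂ⦄, Literature.AlgebraicGeometry.Motives.IsSmoothProjective (2 * m') X → ∀ c : Literature.AlgebraicGeometry.HodgeTheory.complexBetti X (2 * m'), Literature.AlgebraicGeometry.HodgeTheory.IsRationalClass c → Literature.AlgebraicGeometry.HodgeTheory.IsOfHodgeType (2 * m') X (2 * m') m' m' c → c ∈ Literature.AlgebraicGeometry.HodgeTheory.algebraicClasses X m') → ∀ ⦃X : Literature.AlgebraicGeometry.Motives.SchemeOver ℂ⦄ (f : X ⟶ Literature.AlgebraicGeometry.Motives.projectiveSpace 2 ℂ), Literature.AlgebraicGeometry.Motives.IsSmoothProjective (2 * m)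 X → Function.Surjective f.left.base → Submodule.span ℂ {c : Literature.AlgebraicGeometry.HodgeTheory.complexBetti X (2 * m) | Literature.AlgebraicGeometry.HodgeTheory.IsRationalClass c ∧ Literature.AlgebraicGeometry.HodgeTheory.IsOfHodgeType (2 * m) X (2 * m) m m c} ≤ Literature.AlgebraicGeometry.HodgeTheory.algebraicClasses X m ⊔ Submodule.span ℂ {c : Literature.AlgebraicGeometry.HodgeTheory.complexBetti X (2 * m) | Literature.AlgebraicGeometry.HodgeTheory.IsRationalClass c ∧ Literature.AlgebraicGeometry.HodgeTheory.IsOfHodgeType (2 * m) X (2 * m) m m c ∧ ∃ T : Set (Literature.AlgebraicGeometry.Motives.projectiveSpace 2 ℂ).left, IsClosed T ∧ T ≠ Set.univ ∧ Literature.AlgebraicGeometry.HodgeTheory.complexBetti.restrictCompl X (f.left.base ⁻¹' T) (2 * m) c = 0} := by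
  intro hA hB m hm ih X f hX hf
  refine Submodule.span_le.mpr ?_
  rintro c ⟨hc, hpp⟩
  -- stub 1: an algebraic class with the same fibre restrictions off a proper closed `T`
  obtain ⟨a, ha, T, hT, hTne, hfib⟩ := hA hm ih f hX hf c hc hpp
  -- stub 2 on the fibre-trivial difference `c - a ∈ V ⊔ A`
  have hV : c - a ∈ Submodule.span ℂ {c : Literature.AlgebraicGeometry.HodgeTheory.complexBetti X (2 * m) | Literature.AlgebraicGeometry.HodgeTheory.IsRationalClass c ∧ Literature.AlgebraicGeometry.HodgeTheory.IsOfHodgeType (2 * m) X (2 * m) m m c} ⊔ Literature.AlgebraicGeometry.HodgeTheory.algebraicClasses X m :=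
    Submodule.sub_mem _ (Submodule.mem_sup_left (Submodule.subset_span ⟨hc, hpp⟩))
      (Submodule.mem_sup_right ha)
  have h := hB hm ih f hX hf (c - a) hV ⟨T, hT, hTne, hfib⟩
  have ha' : a ∈ Literature.AlgebraicGeometry.HodgeTheory.algebraicClasses X m ⊔ Submodule.span ℂ {c : Literature.AlgebraicGeometry.HodgeTheory.complexBetti X (2 * m) | Literature.AlgebraicGeometry.HodgeTheory.IsRationalClass c ∧ Literature.AlgebraicGeometry.HodgeTheory.IsOfHodgeType (2 * m) X (2 * m) m m c ∧ ∃ T : Set (Literature.AlgebraicGeometry.Motives.projectiveSpace 2 ℂ).left, IsClosed T ∧ T ≠ Set.univ ∧ Literature.AlgebraicGeometry.HodgeTheory.complexBetti.restrictCompl X (f.left.base ⁻¹' T) (2 * m) c = 0} := Submodule.mem_sup_left ha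
  simpa using Submodule.add_mem _ h ha'

end Summit.HodgeConjecture.HodgeConjecture.Cruxes.SummitGrantedFourfolds.HigherNetClassesBirth

end
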